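import Literature.NumberTheory.GaloisRepresentations.CubicEisensteinRamificationBreakProofs
import HarnessLib

/-!
# Ramification of the splitting field of an Eisenstein cubic, III: the totally ramified case
# `e = 6` and the filtration in general (Serre, *Local Fields*, Ch. IV; Silverman *ATAEC* IV.11.1)

`Proofs` file (theorems only, no definitions, no named facts) in topic
`NumberTheory/GaloisRepresentations`, concluding `CubicEisensteinRamificationProofs` (I) and
`CubicEisensteinRamificationBreakProofs` (II) (same seat, bsd.S15; same setting and notation).

**Main theorem** `exists_break`: for `R` Dedekind with fraction field `K`, `L/K` finite Galois with
group `G`, `S = integralClosure R L`, `𝔓 ≠ 0` maximal in `S` with separable residue extension,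
`3 ∈ 𝔭 = 𝔓 ∩ R`, and three distinct `θ₁, θ₂, θ₃ ∈ S` with `∏(X - θᵢ) = X³ + c₂X² + c₁X + c₀`,
`cᵢ ∈ R`, Eisenstein at `𝔭`, permuted faithfully by `G`: there are `b ≥ 1` and
`n = v_𝔭(disc) ≥ 3` (`disc = c₂²c₁² - 4c₁³ - 4c₂³c₀ - 27c₀² + 18c₂c₁c₀`) such that for `i ≥ 1`
the lower ramification group `G_i` of `𝔓` is non-trivial iff `i ≤ b`, in which case `#G_i = 3`,
and **`6b = #G₀ · (n - 2)`**.  Hence Silverman's `δ = Σ_{i≥1} (g_i/g_0)·2` equals `n - 2` for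
such a prime — the Galois side of Ogg's formula for the wild Kodaira types at `p = 3`
(*ATAEC*, proof of Thm. IV.11.1, PDF pp. 366–370).

The case `e = #G₀ = 3` is in part II.  This file treats **`e = 6`**, where `𝔓` is totally
ramified (`inertia_eq_top_of_card_eq_six`; `𝔭S = 𝔓⁶`, `map_under_eq_pow_of_inertia_eq_top`):

* `smul_sub_pow_mul_mem_pow_succ`, `multiplier_add_one_mem`, `odd_of_smul_eq_neg` — over any
  Dedekind domain: an inertia element `σ` acts on `𝔓ᵐ/𝔓ᵐ⁺¹` by `uᵐ`, `u` its multiplier on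
  `𝔓/𝔓²` (Serre IV §2 Prop. 7); if `σ² = 1` and `σ ∉ G₁` then `u ≡ -1`, so (for `2 ∉ 𝔓`) an
  anti-invariant `σd = -d` has **odd** order;
* `odd_ord_sub_of_card_inertia_eq_six` — hence `t = v_𝔓(θ₁ - θ₂) = v_𝔭(disc)` is odd when
  `e = 6` (`G ≅ S₃` has an involution moving a root; the book's *"`M = K(√Δ)` is a ramified
  extension of degree `2`"*, PDF p. 367);
* `exists_uniformizer_of_card_inertia_eq_six` — **a uniformizer `y` of `𝔓` with
  `v_𝔓(τy - y) = t - 1`** for the `3`-cycle `τ`: with `t = 2k + 1`, `D = ∏_{i<j}(θᵢ - θⱼ)`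
  (`τ`-invariant, `v = 3t`), `π ∈ 𝔭 ∖ 𝔭²` (`v = 6`) and a suitable `s ∈ R ∖ 𝔭`
  (`exists_notMem_mul_pow_le_span`), `s D θ₁² = π^{k+1} y`; then `v(y) = 3t + 4 - 6(k+1) = 1` and
  `π^{k+1}(τy - y) = s D (θ₂ - θ₁)(θ₂ + θ₁)` gives `v(τy - y) = 2k` — the book's
  *"`π_L = π_M/α` … `r = v_L(π_L^σ - π_L) = v_L(α - α^σ) - 1`"* (pp. 369–370) inside `S`;
* `exists_break_of_card_inertia_eq_six` (`b = t - 2`, `6b = 6(n - 2)`) and `exists_break`.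

No definitions, no named facts.  All axioms `propext`, `Classical.choice`, `Quot.sound`.

## References

* J.-P. Serre, *Local Fields*, GTM 67 (1979): Ch. I §7 (Prop. 19, 21 and Cor.); Ch. IV §1
  (Lemma 1, Prop. 2), §2 (Prop. 5, Prop. 7 and Cor. 1, 3). [SerreLocalFields1979]
* J. H. Silverman, *Advanced Topics in the Arithmetic of Elliptic Curves*, GTM 151 (1994), proof of
  Thm. IV.11.1 for `p = 3` (PDF pp. 366–370). [SilvermanATAEC1994]
-/

noncomputable section

open scoped Pointwise

namespace Literature.NumberTheory.GaloisRepresentations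

variable (R : Type*) {K L : Type*} [CommRing R] [IsDedekindDomain R] [Field K] [Field L]
  [Algebra R K] [IsFractionRing R K] [Algebra R L] [Algebra K L] [IsScalarTower R K L]
  [FiniteDimensional K L] [IsGalois K L]
  (𝔓 : Ideal (integralClosure R L)) [𝔓.IsMaximal]

variable {R}

/-! ### `#G₀ = 6`: the prime is totally ramified -/

omit [IsDedekindDomain R] [IsFractionRing R K] [IsGalois K L] [𝔓.IsMaximal] in
/-- If `#G₀ = 6` and `G` acts faithfully on the three distinct roots (`#G ∣ 6`), then `G₀ = G`:
`𝔓` is totally ramified in `L/K`. [folklore] -/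
theorem inertia_eq_top_of_card_eq_six {θ₁ θ₂ θ₃ : integralClosure R L} {c₂ c₁ c₀ : R}
    (hV₁ : θ₁ + θ₂ + θ₃ = -algebraMap R _ c₂) (hV₂ : θ₁ * θ₂ + θ₁ * θ₃ + θ₂ * θ₃ = algebraMap R _ c₁)
    (hV₃ : θ₁ * θ₂ * θ₃ = -algebraMap R _ c₀)
    (h12 : θ₁ ≠ θ₂) (h13 : θ₁ ≠ θ₃) (h23 : θ₂ ≠ θ₃)
    (hfaith : ∀ g : L ≃ₐ[K] L, g • θ₁ = θ₁ → g • θ₂ = θ₂ → g • θ₃ = θ₃ → g = 1)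
    (hcard : Nat.card (𝔓.inertia (L ≃ₐ[K] L)) = 6) :
    𝔓.inertia (L ≃ₐ[K] L) = ⊤ ∧ Nat.card (L ≃ₐ[K] L) = 6 := by
  have h6 : Nat.card (L ≃ₐ[K] L) ∣ 6 := card_dvd_six (K := K) hV₁ hV₂ hV₃ h12 h13 h23 hfaith
  have hle : Nat.card (L ≃ₐ[K] L) ≤ 6 := Nat.le_of_dvd (by norm_num) h6
  have hge : 6 ≤ Nat.card (L ≃ₐ[K] L) := by
    rw [← hcard]
    exact Nat.le_of_dvd Nat.card_pos (Subgroup.card_subgroup_dvd_card _)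
  have hG : Nat.card (L ≃ₐ[K] L) = 6 := le_antisymm hle hge
  exact ⟨Subgroup.eq_top_of_card_eq _ (by rw [hcard, hG]), hG⟩

include K in
/-- At a totally ramified prime every `g ∈ G` fixes `𝔓`, so **`𝔓` is the only prime of `S`
over `𝔭`** (the primes over `𝔭` are conjugate, `Algebra.IsInvariant.exists_smul_of_under_eq`).
Ref: Serre, *Local Fields*, Ch. I §7 Prop. 19. [cite: SerreLocalFields1979, Ch. I §7 Prop. 19] -/
theorem eq_of_under_eq_of_inertia_eq_top (htot : 𝔓.inertia (L ≃ₐ[K] L) = ⊤)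
    (Q : Ideal (integralClosure R L)) [Q.IsPrime] (hQ : Q.under R = 𝔓.under R) : Q = 𝔓 := by
  haveI := isInvariant_integralClosure R (K := K) (L := L)
  obtain ⟨g, hg⟩ := Algebra.IsInvariant.exists_smul_of_under_eq R (integralClosure R L) (L ≃ₐ[K] L)
    𝔓 Q hQ.symm
  rw [hg, smul_eq_of_inertia_eq_top htot g]

include K in
/-- **`𝔭S = 𝔓⁶`** — more generally `𝔭S = 𝔓ᵉ` at a totally ramified prime: every prime factor
of `𝔭S` lies over `𝔭`, hence is `𝔓` (`eq_of_under_eq_of_inertia_eq_top`), and `𝔓` occurs with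
multiplicity `e(𝔓|𝔭)` (`Ideal.IsDedekindDomain.ramificationIdx'_eq_normalizedFactors_count`).
Ref: Serre, *Local Fields*, Ch. I §7 (`𝔭A_L = 𝔓ᵉ` when `g = 1`). [cite: SerreLocalFields1979, Ch. I §7 Cor. to Prop. 21] -/
theorem map_under_eq_pow_of_inertia_eq_top (h𝔓 : 𝔓 ≠ ⊥) (htot : 𝔓.inertia (L ≃ₐ[K] L) = ⊤) :
    (𝔓.under R).map (algebraMap R (integralClosure R L)) =
      𝔓 ^ (𝔓.under R).ramificationIdx' 𝔓 := by
  classical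
  haveI : IsDedekindDomain (integralClosure R L) := integralClosure.isDedekindDomain R K L
  haveI := faithfulSMul_integralClosure R (K := K) (L := L)
  haveI : Module.Finite R (integralClosure R L) :=
    IsIntegralClosure.finite R K L (integralClosure R L)
  haveI : Module.IsTorsionFree R (integralClosure R L) := by
    rw [Module.isTorsionFree_iff_faithfulSMul]; infer_instance
  have hp : 𝔓.under R ≠ ⊥ := Ideal.IsIntegral.comap_ne_bot _ h𝔓
  set I := (𝔓.under R).map (algebraMap R (integralClosure R L)) with hI
  have hI0 : I ≠ ⊥ := Ideal.map_ne_bot_of_ne_bot hp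
  -- every normalized factor of `I` is `𝔓`
  have hfac : ∀ Q ∈ UniqueFactorizationMonoid.normalizedFactors I, Q = 𝔓 := by
    intro Q hQ
    have hQprime : Q.IsPrime := Ideal.isPrime_of_prime
      (UniqueFactorizationMonoid.prime_of_normalized_factor Q hQ)
    have hQne : Q ≠ ⊥ := (UniqueFactorizationMonoid.prime_of_normalized_factor Q hQ).ne_zero
    have hIQ : I ≤ Q := Ideal.le_of_dvd (UniqueFactorizationMonoid.dvd_of_mem_normalizedFactors hQ)
    haveI := hQprime
    haveI : (𝔓.under R).IsMaximal := Ideal.IsMaximal.under R 𝔓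
    have hunder : Q.under R = 𝔓.under R := by
      refine ((Ideal.IsMaximal.under R 𝔓).eq_of_le (Ideal.IsPrime.under R Q).ne_top ?_).symm
      exact Ideal.map_le_iff_le_comap.mp hIQ
    exact eq_of_under_eq_of_inertia_eq_top (K := K) 𝔓 htot Q hunder
  have hrep : UniqueFactorizationMonoid.normalizedFactors I =
      Multiset.replicate (Multiset.card (UniqueFactorizationMonoid.normalizedFactors I)) 𝔓 :=
    Multiset.eq_replicate_card.mpr hfac
  have hcount : (UniqueFactorizationMonoid.normalizedFactors I).count 𝔓 =
      (𝔓.under R).ramificationIdx' 𝔓 :=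
    (Ideal.IsDedekindDomain.ramificationIdx'_eq_normalizedFactors_count hI0 inferInstance h𝔓).symm
  rw [← Ideal.prod_normalizedFactors_eq_self hI0, hrep, Multiset.prod_replicate, ← hcount, hrep,
    Multiset.count_replicate_self, Multiset.card_replicate]


/-! ### An involution of `G₀ ∖ G₁` acts by `-1` on `𝔓ⁿ/𝔓ⁿ⁺¹`: parity of `v_𝔓` of anti-invariants -/

section Graded

variable {B : Type*} [CommRing B] [IsDedekindDomain B] (P : Ideal B) [P.IsMaximal]
  {G : Type*} [Group G] [MulSemiringAction G B]

omit [IsDedekindDomain B] [P.IsMaximal] in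
/-- `(a + r)ᵐ - aᵐ ∈ 𝔓ᵐ⁺¹` for `a ∈ 𝔓`, `r ∈ 𝔓²`. [folklore] -/
theorem add_pow_sub_pow_mem_pow_succ {a r : B} (ha : a ∈ P) (hr : r ∈ P ^ 2) (m : ℕ) :
    (a + r) ^ m - a ^ m ∈ P ^ (m + 1) := by
  induction m with
  | zero => simp
  | succ m ih =>
    have key : (a + r) ^ (m + 1) - a ^ (m + 1) = (a + r) * ((a + r) ^ m - a ^ m) + r * a ^ m := by
      ring
    rw [key]
    refine Ideal.add_mem _ ?_ ?_
    · rw [show m + 1 + 1 = 1 + (m + 1) by ring, pow_add, pow_one]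
      exact Ideal.mul_mem_mul (Ideal.add_mem _ ha (Ideal.pow_le_self two_ne_zero hr)) ih
    · rw [show m + 1 + 1 = 2 + m by ring, pow_add]
      exact Ideal.mul_mem_mul hr (Ideal.pow_mem_pow ha m)

/-- **An inertia element acts on `𝔓ᵐ/𝔓ᵐ⁺¹` through the `m`-th power of its multiplier on
`𝔓/𝔓²`.**  Let `σ` fix `𝔓` with `σb - b ∈ 𝔓` for all `b`, `ϖ ∈ 𝔓 ∖ 𝔓²` a uniformizer and
`u` with `σϖ - uϖ ∈ 𝔓²`.  Then `σx - uᵐx ∈ 𝔓ᵐ⁺¹` for every `x ∈ 𝔓ᵐ`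
(write `x = ϖᵐw + x'`, `exists_eq_pow_mul_add_of_mem_pow`).  Serre, *Local Fields*, Ch. IV §2,
Prop. 7 and its proof (the maps `θ_i : G_i/G_{i+1} → U^i/U^{i+1}`).
[cite: SerreLocalFields1979, Ch. IV §2 Prop. 7] -/
theorem smul_sub_pow_mul_mem_pow_succ (hP : P ≠ ⊥) {σ : G} (hσ : σ • P = P)
    (hσI : ∀ b : B, σ • b - b ∈ P) {ϖ u : B} (hϖ : ϖ ∈ P) (hϖ2 : ϖ ∉ P ^ 2)
    (hu : σ • ϖ - u * ϖ ∈ P ^ 2) {m : ℕ} {x : B} (hx : x ∈ P ^ m) :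
    σ • x - u ^ m * x ∈ P ^ (m + 1) := by
  obtain ⟨w, x', hx', rfl⟩ := exists_eq_pow_mul_add_of_mem_pow P hP hϖ hϖ2 hx
  -- `(σϖ)ᵐ ≡ (uϖ)ᵐ`
  have h1 : (σ • ϖ) ^ m - (u * ϖ) ^ m ∈ P ^ (m + 1) := by
    have := add_pow_sub_pow_mem_pow_succ P (Ideal.mul_mem_left _ u hϖ) hu m
    rwa [add_sub_cancel] at this
  have h2 : (u * ϖ) ^ m * (σ • w - w) ∈ P ^ (m + 1) := by
    rw [pow_succ, mul_pow]
    exact Ideal.mul_mem_mul (Ideal.mul_mem_left _ _ (Ideal.pow_mem_pow hϖ m)) (hσI w)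
  have h3 : σ • x' ∈ P ^ (m + 1) := smul_mem_pow_of_smul_eq P hσ hx'
  have h4 : u ^ m * x' ∈ P ^ (m + 1) := Ideal.mul_mem_left _ _ hx'
  have key : σ • (ϖ ^ m * w + x') - u ^ m * (ϖ ^ m * w + x') =
      ((σ • ϖ) ^ m - (u * ϖ) ^ m) * (σ • w) + (u * ϖ) ^ m * (σ • w - w) + (σ • x' - u ^ m * x') := by
    rw [smul_add, smul_mul', smul_pow']
    ring
  rw [key]
  exact Ideal.add_mem _ (Ideal.add_mem _ (Ideal.mul_mem_right _ _ h1) h2) (Ideal.sub_mem _ h3 h4)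

/-- **The multiplier of an involution of `G₀ ∖ G₁` is `-1`.**  With `σ, ϖ, u` as in
`smul_sub_pow_mul_mem_pow_succ`, if `σ² = 1` and `σϖ - ϖ ∉ 𝔓²` (`σ ∉ G₁`) then `u + 1 ∈ 𝔓`:
`u² ≡ 1` (apply `σ` twice) and `u ≢ 1`.  Serre, *Local Fields*, Ch. IV §2, Cor. 1 of Prop. 7
(`G₀/G₁ ↪ k*`). [cite: SerreLocalFields1979, Ch. IV §2 Prop. 7 and Cor. 1] -/
theorem multiplier_add_one_mem (hP : P ≠ ⊥) {σ : G} (hσ : σ • P = P)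
    (hσI : ∀ b : B, σ • b - b ∈ P) (hσ2 : σ ^ 2 = 1) {ϖ u : B} (hϖ : ϖ ∈ P) (hϖ2 : ϖ ∉ P ^ 2)
    (hu : σ • ϖ - u * ϖ ∈ P ^ 2) (hwild : σ • ϖ - ϖ ∉ P ^ 2) : u + 1 ∈ P := by
  -- `u² ≡ 1 mod 𝔓`
  have hσϖ : σ • ϖ ∈ P := by
    have : σ • ϖ ∈ σ • P := Ideal.smul_mem_pointwise_smul_iff.mpr hϖ
    rwa [hσ] at this
  have hsq : (1 - u ^ 2) * ϖ ∈ P ^ 2 := by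
    have h1 := smul_sub_pow_mul_mem_pow_succ P hP hσ hσI hϖ hϖ2 hu (m := 1) (x := σ • ϖ)
      (by rw [pow_one]; exact hσϖ)
    rw [pow_one, smul_smul, ← pow_two, hσ2, one_smul] at h1
    have h2 : u * (σ • ϖ - u * ϖ) ∈ P ^ 2 := Ideal.mul_mem_left _ _ hu
    have key : (1 - u ^ 2) * ϖ = (ϖ - u * (σ • ϖ)) + u * (σ • ϖ - u * ϖ) := by ring
    rw [key]
    exact Ideal.add_mem _ h1 h2
  have hu2 : 1 - u ^ 2 ∈ P := by
    by_contra h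
    apply hϖ2
    -- `ord((1 - u²) ϖ) = ord ϖ = 1 < 2`
    have hord : ord P ((1 - u ^ 2) * ϖ) = ord P ϖ := by
      rw [ord_mul P hP, (ord_eq_zero_iff P).mpr h, zero_add]
    have := (mem_pow_iff_le_ord P).mp hsq
    rw [hord] at this
    exact (mem_pow_iff_le_ord P).mpr this
  -- `u ≢ 1`
  have hu1 : u - 1 ∉ P := by
    intro h
    apply hwild
    have key : σ • ϖ - ϖ = (σ • ϖ - u * ϖ) + (u - 1) * ϖ := by ring
    rw [key]
    refine Ideal.add_mem _ hu ?_
    rw [pow_two]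
    exact Ideal.mul_mem_mul h hϖ
  -- `(u - 1)(u + 1) = -(1 - u²) ∈ 𝔓`
  have hprod : (u - 1) * (u + 1) ∈ P := by
    have : (u - 1) * (u + 1) = -(1 - u ^ 2) := by ring
    rw [this]
    exact Submodule.neg_mem _ hu2
  exact ((Ideal.IsPrime.mem_or_mem inferInstance hprod).resolve_left hu1)

/-- **The order of an anti-invariant of an involution of `G₀ ∖ G₁` is odd** (when `2 ∉ 𝔓`):
if `σd = -d` with `d ∈ 𝔓ⁿ ∖ 𝔓ⁿ⁺¹`, then `n` is odd — `σ` acts on `𝔓ⁿ/𝔓ⁿ⁺¹` by `uⁿ ≡ (-1)ⁿ`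
(`smul_sub_pow_mul_mem_pow_succ`, `multiplier_add_one_mem`), and `-d ≡ d` would force
`2d ∈ 𝔓ⁿ⁺¹`.  This is the classical fact that the quadratic subextension cut out by an element of
order `2` of the inertia group at an odd residue characteristic is `K(√π)`-like: anti-invariant
elements have odd valuation (cf. Silverman *ATAEC* p. 367: *"`π_M = π_K^{-1}√Δ` is a uniformizer
for `M`"* when `v_K(Δ)` is odd). [cite: SerreLocalFields1979, Ch. IV §2 Prop. 7 and Cor. 1]
[cite: SilvermanATAEC1994, proof of Thm. IV.11.1 for p = 3 (PDF p. 367)] -/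
theorem odd_of_smul_eq_neg (hP : P ≠ ⊥) (h2 : (2 : B) ∉ P) {σ : G} (hσ : σ • P = P)
    (hσI : ∀ b : B, σ • b - b ∈ P) (hσ2 : σ ^ 2 = 1) {ϖ : B} (hϖ : ϖ ∈ P) (hϖ2 : ϖ ∉ P ^ 2)
    (hwild : σ • ϖ - ϖ ∉ P ^ 2) {d : B} {n : ℕ} (hd : d ∈ P ^ n) (hd' : d ∉ P ^ (n + 1))
    (hσd : σ • d = -d) : Odd n := by
  -- the multiplier `u`
  have hσϖ : σ • ϖ ∈ P := by
    have : σ • ϖ ∈ σ • P := Ideal.smul_mem_pointwise_smul_iff.mpr hϖ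
    rwa [hσ] at this
  obtain ⟨u, r, hr, hur⟩ := exists_eq_pow_mul_add_of_mem_pow P hP hϖ hϖ2 (k := 1)
    (by rw [pow_one]; exact hσϖ)
  rw [pow_one] at hur
  have hu : σ • ϖ - u * ϖ ∈ P ^ 2 := by
    rw [hur]; convert hr using 1; ring
  have hu1 : u + 1 ∈ P := multiplier_add_one_mem P hP hσ hσI hσ2 hϖ hϖ2 hu hwild
  -- if `n` were even, `uⁿ ≡ 1` and `σd ≡ d`
  by_contra hodd
  rw [Nat.not_odd_iff_even] at hodd
  obtain ⟨k, rfl⟩ := hodd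
  have hun : u ^ (k + k) - 1 ∈ P := by
    have key : u ^ (k + k) - 1 = (∑ i ∈ Finset.range k, (u ^ 2) ^ i) * (u ^ 2 - 1) := by
      rw [geom_sum_mul, ← pow_mul, two_mul]
    rw [key]
    refine Ideal.mul_mem_left _ _ ?_
    have : u ^ 2 - 1 = (u + 1) * (u - 1) := by ring
    rw [this]
    exact Ideal.mul_mem_right _ _ hu1
  have h1 : σ • d - u ^ (k + k) * d ∈ P ^ (k + k + 1) :=
    smul_sub_pow_mul_mem_pow_succ P hP hσ hσI hϖ hϖ2 hu hd
  rw [hσd] at h1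
  -- `-d - uⁿ d = -(uⁿ - 1) d - 2 d`
  have h2' : (u ^ (k + k) - 1) * d ∈ P ^ (k + k + 1) := by
    rw [pow_succ']
    exact Ideal.mul_mem_mul hun hd
  have h3 : (2 : B) * d ∈ P ^ (k + k + 1) := by
    have key : (2 : B) * d = -((-d - u ^ (k + k) * d) + (u ^ (k + k) - 1) * d) := by ring
    rw [key]
    exact Submodule.neg_mem _ (Ideal.add_mem _ h1 h2')
  apply hd'
  -- `2 ∉ 𝔓` and `𝔓ⁿ⁺¹` is `𝔓`-primary
  have hord : ord P ((2 : B) * d) = ord P d := by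
    rw [ord_mul P hP, (ord_eq_zero_iff P).mpr h2, zero_add]
  have := (mem_pow_iff_le_ord P).mp h3
  rw [hord] at this
  exact (mem_pow_iff_le_ord P).mpr this

end Graded


/-! ### The case `e = 6`: `v_𝔭(disc)` is odd -/

include K in
/-- **If `#G₀ = 6` then `t = v_𝔓(θ₁ - θ₂)` is odd** (and `v_𝔭(disc) = t`): `G` has an element `σ`
of order `2` (Cauchy), which lies in `G₀ = G` but not in the `3`-group `G₁`, and moves a root,
`σθⱼ = θₖ ≠ θⱼ`; then `d = θⱼ - θₖ` is anti-invariant, `σd = -d`, of order `t`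
(`ord_sub_eq_of_three_cycle`), so `t` is odd by `odd_of_smul_eq_neg`.  In Silverman's proof this is
the remark that `M = K(√Δ)` is a *ramified* quadratic extension in the degree-`6` case (PDF
pp. 366–367). [cite: SilvermanATAEC1994, proof of Thm. IV.11.1 for p = 3 (PDF pp. 366–367)]
[cite: SerreLocalFields1979, Ch. IV §2 Prop. 7 and Cor. 1] -/
theorem odd_ord_sub_of_card_inertia_eq_six
    [Algebra.IsSeparable (R ⧸ 𝔓.under R) (integralClosure R L ⧸ 𝔓)] (h𝔓 : 𝔓 ≠ ⊥)
    (h2 : (2 : integralClosure R L) ∉ 𝔓) (h3 : (3 : integralClosure R L) ∈ 𝔓)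
    {θ₁ θ₂ θ₃ : integralClosure R L} {c₂ c₁ c₀ : R}
    (hV₁ : θ₁ + θ₂ + θ₃ = -algebraMap R _ c₂) (hV₂ : θ₁ * θ₂ + θ₁ * θ₃ + θ₂ * θ₃ = algebraMap R _ c₁)
    (hV₃ : θ₁ * θ₂ * θ₃ = -algebraMap R _ c₀)
    (h12 : θ₁ ≠ θ₂) (h13 : θ₁ ≠ θ₃) (h23 : θ₂ ≠ θ₃)
    (hfaith : ∀ g : L ≃ₐ[K] L, g • θ₁ = θ₁ → g • θ₂ = θ₂ → g • θ₃ = θ₃ → g = 1)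
    {τ : L ≃ₐ[K] L} (hτ𝔓 : τ • 𝔓 = 𝔓) (hτ1 : τ • θ₁ = θ₂) (hτ2 : τ • θ₂ = θ₃) (hτ3 : τ • θ₃ = θ₁)
    (hcard : Nat.card (𝔓.inertia (L ≃ₐ[K] L)) = 6) {t : ℕ} (ht : ord 𝔓 (θ₁ - θ₂) = t) : Odd t := by
  haveI : IsDedekindDomain (integralClosure R L) := integralClosure.isDedekindDomain R K L
  obtain ⟨htot, hG⟩ := inertia_eq_top_of_card_eq_six (K := K) 𝔓 hV₁ hV₂ hV₃ h12 h13 h23 hfaith hcard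
  have h6 : Nat.card (L ≃ₐ[K] L) ∣ 6 := by rw [hG]
  -- an involution `σ`
  haveI : Fact (Nat.Prime 2) := ⟨Nat.prime_two⟩
  obtain ⟨σ, hσord⟩ := exists_prime_orderOf_dvd_card' (G := L ≃ₐ[K] L) 2 (by rw [hG]; norm_num)
  have hσ2 : σ ^ 2 = 1 := by rw [← hσord, pow_orderOf_eq_one]
  have hσne : σ ≠ 1 := fun h ↦ by rw [h, orderOf_one] at hσord; exact absurd hσord (by norm_num)
  have hσI : σ ∈ 𝔓.inertia (L ≃ₐ[K] L) := htot ▸ Subgroup.mem_top σ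
  have hσI' : ∀ b : integralClosure R L, σ • b - b ∈ 𝔓 := fun b ↦ AddSubgroup.mem_inertia.mp hσI b
  have hσ𝔓 : σ • 𝔓 = 𝔓 := 𝔓.inertia_le_stabilizer hσI
  -- `σ ∉ G₁`
  obtain ⟨ϖ, hϖ, hϖ2⟩ := Ideal.exists_mem_pow_notMem_pow_succ 𝔓 h𝔓 Ideal.IsPrime.ne_top' 1
  rw [pow_one] at hϖ
  have hwild : σ • ϖ - ϖ ∉ 𝔓 ^ 2 := by
    intro h
    have hσ1 : σ ∈ 𝔓.ramificationSubgroup (L ≃ₐ[K] L) 1 :=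
      (mem_ramificationSubgroup_iff_of_mem_inertia (K := K) 𝔓 h𝔓 hσI hϖ hϖ2 1).mpr h
    have := orderOf_eq_three_of_mem_ramificationSubgroup (K := K) 𝔓 h3 h6 le_rfl hσ1 hσne
    rw [hσord] at this
    exact absurd this (by norm_num)
  -- an anti-invariant root difference `d` of order `t`
  obtain ⟨o23, o13⟩ := ord_sub_eq_of_three_cycle 𝔓 hτ𝔓 hτ1 hτ2 hτ3
  have hanti : ∃ d : integralClosure R L, σ • d = -d ∧ ord 𝔓 d = t := by
    have hσσ : ∀ x : integralClosure R L, σ • σ • x = x := fun x ↦ by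
      rw [smul_smul, ← pow_two, hσ2, one_smul]
    rcases smul_mem_roots (K := K) hV₁ hV₂ hV₃ σ (Or.inl rfl) with h1 | h1 | h1
    · -- `σ` fixes `θ₁`, hence moves `θ₂` to `θ₃`
      rcases smul_mem_roots (K := K) hV₁ hV₂ hV₃ σ (Or.inr (Or.inl rfl)) with h2' | h2' | h2'
      · exact absurd (smul_left_cancel σ (h1.trans h2'.symm)) h12
      · rcases smul_mem_roots (K := K) hV₁ hV₂ hV₃ σ (Or.inr (Or.inr rfl)) with h3' | h3' | h3'
        · exact absurd (smul_left_cancel σ (h1.trans h3'.symm)) h13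
        · exact absurd (smul_left_cancel σ (h2'.trans h3'.symm)) h23
        · exact absurd (hfaith σ h1 h2' h3') hσne
      · refine ⟨θ₂ - θ₃, ?_, o23.trans ht⟩
        rw [smul_sub, h2', ← h2', hσσ, neg_sub]
    · refine ⟨θ₁ - θ₂, ?_, ht⟩
      rw [smul_sub, h1, ← h1, hσσ, neg_sub]
    · refine ⟨θ₁ - θ₃, ?_, o13.trans ht⟩
      rw [smul_sub, h1, ← h1, hσσ, neg_sub]
  obtain ⟨d, hσd, hd⟩ := hanti
  have hdmem : d ∈ 𝔓 ^ t := (mem_pow_iff_le_ord 𝔓).mpr hd.ge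
  have hdnmem : d ∉ 𝔓 ^ (t + 1) := fun h ↦ by
    have := (mem_pow_iff_le_ord 𝔓).mp h
    rw [hd] at this
    exact absurd (by exact_mod_cast this : t + 1 ≤ t) (by omega)
  exact odd_of_smul_eq_neg 𝔓 h𝔓 h2 hσ𝔓 hσI' hσ2 hϖ hϖ2 hwild hdmem hdnmem hσd

/-! ### The case `e = 6`: a uniformizer `y` with `v_𝔓(τy - y) = t - 1` -/

omit [IsDedekindDomain R] [IsFractionRing R K] [FiniteDimensional K L] [IsGalois K L]
  [𝔓.IsMaximal] in
/-- `τ` fixes `D = (θ₁ - θ₂)(θ₁ - θ₃)(θ₂ - θ₃)` (an even permutation of the roots). [folklore] -/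
theorem smul_prod_sub_eq {θ₁ θ₂ θ₃ : integralClosure R L} {τ : L ≃ₐ[K] L}
    (hτ1 : τ • θ₁ = θ₂) (hτ2 : τ • θ₂ = θ₃) (hτ3 : τ • θ₃ = θ₁) :
    τ • ((θ₁ - θ₂) * (θ₁ - θ₃) * (θ₂ - θ₃)) = (θ₁ - θ₂) * (θ₁ - θ₃) * (θ₂ - θ₃) := by
  rw [smul_mul', smul_mul', smul_sub, smul_sub, smul_sub, hτ1, hτ2, hτ3]
  ring

omit [IsFractionRing R K] [FiniteDimensional K L] [IsGalois K L] in
/-- In `R`: for `π ∈ 𝔭 ∖ 𝔭²` and `c : ℕ` there is `s ∈ R ∖ 𝔭` with `s · 𝔭ᶜ ⊆ (πᶜ)` (the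
prime-to-`𝔭` part of `(πᶜ)`; `(πᶜ) = 𝔭ᶜ 𝔞` with `𝔭 ∤ 𝔞`). [folklore] -/
theorem exists_notMem_mul_pow_le_span {p : Ideal R} [p.IsMaximal] (hp : p ≠ ⊥) {π : R}
    (hπ : π ∈ p) (hπ2 : π ∉ p ^ 2) (c : ℕ) :
    ∃ s : R, s ∉ p ∧ ∀ x ∈ p ^ c, s * x ∈ Ideal.span {π ^ c} := by
  classical
  have hπ0 : π ≠ 0 := by rintro rfl; exact hπ2 (zero_mem _)
  have hord : ord p (π ^ c) = (c : ℕ∞) := by rw [ord_pow p hp, ord_eq_one p hπ hπ2, mul_one]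
  have hfin : FiniteMultiplicity p (Ideal.span {π ^ c}) := by
    rw [finiteMultiplicity_iff_emultiplicity_ne_top]
    change ord p (π ^ c) ≠ ⊤
    rw [hord]; exact ENat.coe_ne_top c
  obtain ⟨𝔞, h𝔞, hndvd⟩ := hfin.exists_eq_pow_mul_and_not_dvd
  have hmult : multiplicity p (Ideal.span {π ^ c}) = c := by
    have h := hfin.emultiplicity_eq_multiplicity
    change ord p (π ^ c) = _ at h
    rw [hord] at h
    exact_mod_cast h.symm
  rw [hmult] at h𝔞
  have hle : ¬ 𝔞 ≤ p := fun h ↦ hndvd (Ideal.dvd_iff_le.mpr h)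
  obtain ⟨s, hs𝔞, hsp⟩ := Set.not_subset.mp hle
  refine ⟨s, hsp, fun x hx ↦ ?_⟩
  rw [h𝔞, mul_comm (p ^ c) 𝔞]
  exact Ideal.mul_mem_mul hs𝔞 hx

include K in
/-- **A uniformizer of the totally ramified case.**  In the setting of
`odd_ord_sub_of_card_inertia_eq_six` (`#G₀ = 6`, `v_𝔓(θ₁) = 2`, all root differences of odd order
`t = 2k + 1 ≥ 3`), write `D = (θ₁-θ₂)(θ₁-θ₃)(θ₂-θ₃)` (`τ`-invariant, of order `3t`) and let
`π ∈ 𝔭 ∖ 𝔭²` (so `v_𝔓(π) = 6`).  Then `v_𝔓(D θ₁²) = 3t + 4 = 6(k+1) + 1`, and after multiplying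
by a suitable `s ∈ R ∖ 𝔭` the element `s D θ₁²` is `π^{k+1} y` with `y ∈ S`
(`𝔭S = 𝔓⁶`, `map_under_eq_pow_of_inertia_eq_top`; `exists_notMem_mul_pow_le_span`): **`y` is a
uniformizer of `𝔓` and `v_𝔓(τy - y) = t - 1`**, because
`π^{k+1}(τy - y) = s D (θ₂² - θ₁²) = s D (θ₂ - θ₁)(θ₂ + θ₁)` has order `3t + t + 2`.  This is
Silverman's *"`π_L = π_M/α` will be a uniformizer for `L` … `r = v_L(π_L^σ - π_L)` …
`= v_L(α - α^σ) - 1`"* (PDF pp. 369–370), carried out inside the ring of integers.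
[cite: SilvermanATAEC1994, proof of Thm. IV.11.1 for p = 3 (PDF pp. 369–370)] -/
theorem exists_uniformizer_of_card_inertia_eq_six
    [Algebra.IsSeparable (R ⧸ 𝔓.under R) (integralClosure R L ⧸ 𝔓)] (h𝔓 : 𝔓 ≠ ⊥)
    (h2 : (2 : integralClosure R L) ∉ 𝔓)
    {θ₁ θ₂ θ₃ : integralClosure R L} {c₂ c₁ c₀ : R}
    (hV₁ : θ₁ + θ₂ + θ₃ = -algebraMap R _ c₂) (hV₂ : θ₁ * θ₂ + θ₁ * θ₃ + θ₂ * θ₃ = algebraMap R _ c₁)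
    (hV₃ : θ₁ * θ₂ * θ₃ = -algebraMap R _ c₀)
    (h12 : θ₁ ≠ θ₂) (h13 : θ₁ ≠ θ₃) (h23 : θ₂ ≠ θ₃)
    (hfaith : ∀ g : L ≃ₐ[K] L, g • θ₁ = θ₁ → g • θ₂ = θ₂ → g • θ₃ = θ₃ → g = 1)
    {τ : L ≃ₐ[K] L} (hτ𝔓 : τ • 𝔓 = 𝔓) (hτ1 : τ • θ₁ = θ₂) (hτ2 : τ • θ₂ = θ₃) (hτ3 : τ • θ₃ = θ₁)
    (hcard : Nat.card (𝔓.inertia (L ≃ₐ[K] L)) = 6) (hordθ : ord 𝔓 θ₁ = 2)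
    {k : ℕ} (ht : ord 𝔓 (θ₁ - θ₂) = (2 * k + 1 : ℕ)) (hk : 1 ≤ k) :
    ∃ y : integralClosure R L, y ∈ 𝔓 ∧ y ∉ 𝔓 ^ 2 ∧ ord 𝔓 (τ • y - y) = (2 * k : ℕ) := by
  classical
  haveI : IsDedekindDomain (integralClosure R L) := integralClosure.isDedekindDomain R K L
  obtain ⟨htot, hG⟩ := inertia_eq_top_of_card_eq_six (K := K) 𝔓 hV₁ hV₂ hV₃ h12 h13 h23 hfaith hcard
  have hp : 𝔓.under R ≠ ⊥ := Ideal.IsIntegral.comap_ne_bot _ h𝔓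
  haveI : (𝔓.under R).IsMaximal := Ideal.IsMaximal.under R 𝔓
  have he6 : (𝔓.under R).ramificationIdx' 𝔓 = 6 := by
    rw [ramificationIdx'_under_base_eq_card_inertia (K := K) 𝔓 h𝔓, hcard]
  -- `π ∈ 𝔭 ∖ 𝔭²`, `v_𝔓(π) = 6`
  obtain ⟨π, hπ, hπ2⟩ := Ideal.exists_mem_pow_notMem_pow_succ (𝔓.under R) hp
    Ideal.IsPrime.ne_top' 1
  rw [pow_one] at hπ
  have hordπ : ord 𝔓 (algebraMap R (integralClosure R L) π) = 6 := by
    rw [ord_algebraMap (K := K) 𝔓 h𝔓, he6, ord_eq_one _ hπ hπ2]; rfl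
  -- `s ∈ R ∖ 𝔭` with `s 𝔭^{k+1} ⊆ (π^{k+1})`
  obtain ⟨s, hsp, hs⟩ := exists_notMem_mul_pow_le_span hp hπ hπ2 (k + 1)
  have hsP : algebraMap R (integralClosure R L) s ∉ 𝔓 := hsp
  have hords : ord 𝔓 (algebraMap R (integralClosure R L) s) = 0 := (ord_eq_zero_iff 𝔓).mpr hsP
  -- orders of `D`, `θ₁²`, `θ₁ + θ₂`
  set D := (θ₁ - θ₂) * (θ₁ - θ₃) * (θ₂ - θ₃) with hD
  obtain ⟨o23, o13⟩ := ord_sub_eq_of_three_cycle 𝔓 hτ𝔓 hτ1 hτ2 hτ3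
  have hordD : ord 𝔓 D = (3 * (2 * k + 1) : ℕ) := by
    rw [hD, ord_mul 𝔓 h𝔓, ord_mul 𝔓 h𝔓, o23, o13, ht]
    norm_cast; ring
  have hordθsq : ord 𝔓 (θ₁ ^ 2) = (4 : ℕ) := by rw [ord_pow 𝔓 h𝔓, hordθ]; rfl
  have hordsum : ord 𝔓 (θ₂ + θ₁) = (2 : ℕ) := by
    have e : θ₂ + θ₁ = (θ₂ - θ₁) + 2 * θ₁ := by ring
    have h2θ : ord 𝔓 (2 * θ₁) = (2 : ℕ) := by
      rw [ord_mul 𝔓 h𝔓, (ord_eq_zero_iff 𝔓).mpr h2, zero_add, hordθ]; rfl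
    have hlt : ord 𝔓 (2 * θ₁) < ord 𝔓 (θ₂ - θ₁) := by
      rw [h2θ, ← ord_neg 𝔓 (θ₂ - θ₁), neg_sub, ht]
      exact_mod_cast (by omega : 2 < 2 * k + 1)
    rw [e, ord_add_eq_of_lt 𝔓 hlt, h2θ]
  -- `D θ₁² ∈ 𝔓^{6(k+1)} = (𝔭^{k+1}) S`
  have hmem : D * θ₁ ^ 2 ∈ ((𝔓.under R) ^ (k + 1)).map (algebraMap R (integralClosure R L)) := by
    rw [Ideal.map_pow, map_under_eq_pow_of_inertia_eq_top (K := K) 𝔓 h𝔓 htot, he6, ← pow_mul,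
      mem_pow_iff_le_ord, ord_mul 𝔓 h𝔓, hordD, hordθsq]
    norm_cast; omega
  -- hence `s D θ₁² = π^{k+1} y`
  have hmem' : algebraMap R _ s * (D * θ₁ ^ 2) ∈
      Ideal.span {algebraMap R (integralClosure R L) (π ^ (k + 1))} := by
    have h1 : algebraMap R (integralClosure R L) s * (D * θ₁ ^ 2) ∈
        (Ideal.span {s}).map (algebraMap R (integralClosure R L)) *
          ((𝔓.under R) ^ (k + 1)).map (algebraMap R (integralClosure R L)) :=
      Ideal.mul_mem_mul (Ideal.mem_map_of_mem _ (Ideal.mem_span_singleton_self s)) hmem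
    rw [← Ideal.map_mul] at h1
    have h2 : Ideal.span {s} * (𝔓.under R) ^ (k + 1) ≤ Ideal.span {π ^ (k + 1)} := by
      rw [Ideal.mul_le]
      intro a ha x hx
      obtain ⟨a, rfl⟩ := Ideal.mem_span_singleton'.mp ha
      rw [mul_assoc]
      exact Ideal.mul_mem_left _ a (hs x hx)
    have h3 := Ideal.map_mono (f := algebraMap R (integralClosure R L)) h2 h1
    rwa [Ideal.map_span, Set.image_singleton] at h3
  obtain ⟨y, hy⟩ := Ideal.mem_span_singleton'.mp hmem'
  -- `hy : y * π^{k+1} = s D θ₁²`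
  have hπk : ord 𝔓 (algebraMap R (integralClosure R L) (π ^ (k + 1))) = (6 * (k + 1) : ℕ) := by
    rw [map_pow, ord_pow 𝔓 h𝔓, hordπ]; norm_cast; ring
  have hπk0 : algebraMap R (integralClosure R L) (π ^ (k + 1)) ≠ 0 := fun h0 ↦ by
    rw [h0, ord_zero] at hπk; exact ENat.top_ne_coe _ hπk
  -- `v(y) = 1`
  have hordy : ord 𝔓 y = 1 := by
    have h := congrArg (ord 𝔓) hy
    rw [ord_mul 𝔓 h𝔓 y, ord_mul 𝔓 h𝔓 (algebraMap R _ s), ord_mul 𝔓 h𝔓 D, hπk, hords, hordD,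
      hordθsq, zero_add] at h
    have hy0 : y ≠ 0 := by
      rintro rfl
      rw [ord_zero, top_add] at h
      exact absurd h (by norm_cast)
    obtain ⟨m, hm⟩ := exists_ord_eq_natCast 𝔓 h𝔓 hy0
    rw [hm] at h ⊢
    have : m + 6 * (k + 1) = 3 * (2 * k + 1) + 4 := by exact_mod_cast h
    have hm1 : m = 1 := by omega
    subst hm1; rfl
  refine ⟨y, ?_, ?_, ?_⟩
  · have := (mem_pow_iff_le_ord 𝔓 (b := y) (n := 1)).mpr (by rw [hordy]; exact le_rfl)
    rwa [pow_one] at this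
  · intro h
    have := (mem_pow_iff_le_ord 𝔓).mp h
    rw [hordy] at this
    exact absurd (by exact_mod_cast this : (2 : ℕ) ≤ 1) (by norm_num)
  · -- `π^{k+1} (τy - y) = s D (θ₂² - θ₁²)`
    have hτy : (τ • y) * algebraMap R _ (π ^ (k + 1)) = algebraMap R _ s * (D * θ₂ ^ 2) := by
      have h := congrArg (τ • ·) hy
      simp only [smul_mul', smul_algebraMap, smul_pow', hτ1] at h
      rw [smul_prod_sub_eq hτ1 hτ2 hτ3] at h
      exact h
    have hdiff : (τ • y - y) * algebraMap R _ (π ^ (k + 1)) =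
        algebraMap R _ s * D * ((θ₂ - θ₁) * (θ₂ + θ₁)) := by
      rw [sub_mul, hτy, hy]; ring
    have h := congrArg (ord 𝔓) hdiff
    rw [ord_mul 𝔓 h𝔓 (τ • y - y), ord_mul 𝔓 h𝔓 (algebraMap R _ s * D), ord_mul 𝔓 h𝔓 _ D,
      ord_mul 𝔓 h𝔓 (θ₂ - θ₁), hπk, hords, hordD, ← ord_neg 𝔓 (θ₂ - θ₁), neg_sub, ht, hordsum,
      zero_add] at h
    have hz : τ • y - y ≠ 0 := by
      intro h0
      rw [h0, ord_zero, top_add] at h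
      exact absurd h (by norm_cast)
    obtain ⟨m, hm⟩ := exists_ord_eq_natCast 𝔓 h𝔓 hz
    rw [hm] at h ⊢
    have : m + 6 * (k + 1) = 3 * (2 * k + 1) + ((2 * k + 1) + 2) := by exact_mod_cast h
    have : m = 2 * k := by omega
    subst this; rfl


/-! ### The case `e = 6`: the filtration -/

include K in
/-- **The lower ramification filtration of the splitting field of an Eisenstein cubic in residue
characteristic `3`, case `e = 6` (totally ramified).**  Same setting and conclusion as
`exists_break_of_card_inertia_eq_three`, now with `#G₀ = 6`: there is `b ≥ 1` (`= t - 2`,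
`t = v_𝔓(θ₁ - θ₂) = v_𝔭(disc)` odd `≥ 3`) with `G_i ≠ 1 ↔ i ≤ b` for `i ≥ 1`, `#G_i = 3` for
`1 ≤ i ≤ b`, and **`6b = #G₀ · (v_𝔭(disc) - 2)`**: the `3`-cycle `τ ∈ G₀` has
`i_G(τ) = v_𝔓(τy - y) = t - 1` for the uniformizer `y` of
`exists_uniformizer_of_card_inertia_eq_six`.  This is the book's `δ(E/K) = δ(E/M)/2`,
`δ(E/M) = 2(r - 1)`, `r = v_M(Δ)/2 - 1` (*ATAEC* PDF pp. 367–370) in the ramified case `[L:K] = 6`.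
[cite: SilvermanATAEC1994, proof of Thm. IV.11.1 for p = 3 (PDF pp. 367–370)]
[cite: SerreLocalFields1979, Ch. IV §1 Lemma 1, Prop. 2] -/
theorem exists_break_of_card_inertia_eq_six
    [Algebra.IsSeparable (R ⧸ 𝔓.under R) (integralClosure R L ⧸ 𝔓)] (h𝔓 : 𝔓 ≠ ⊥)
    (h3 : (3 : R) ∈ 𝔓.under R)
    {θ₁ θ₂ θ₃ : integralClosure R L} {c₂ c₁ c₀ : R}
    (hV₁ : θ₁ + θ₂ + θ₃ = -algebraMap R _ c₂) (hV₂ : θ₁ * θ₂ + θ₁ * θ₃ + θ₂ * θ₃ = algebraMap R _ c₁)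
    (hV₃ : θ₁ * θ₂ * θ₃ = -algebraMap R _ c₀)
    (hc₂ : c₂ ∈ 𝔓.under R) (hc₁ : c₁ ∈ 𝔓.under R) (hc₀ : c₀ ∈ 𝔓.under R)
    (hc₀' : c₀ ∉ (𝔓.under R) ^ 2)
    (h12 : θ₁ ≠ θ₂) (h13 : θ₁ ≠ θ₃) (h23 : θ₂ ≠ θ₃)
    (hfaith : ∀ g : L ≃ₐ[K] L, g • θ₁ = θ₁ → g • θ₂ = θ₂ → g • θ₃ = θ₃ → g = 1)
    (hcard : Nat.card (𝔓.inertia (L ≃ₐ[K] L)) = 6) :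
    ∃ b n : ℕ, 1 ≤ b ∧
      (∀ i, 1 ≤ i → (𝔓.ramificationSubgroup (L ≃ₐ[K] L) i ≠ ⊥ ↔ i ≤ b)) ∧
      (∀ i, 1 ≤ i → i ≤ b → Nat.card (𝔓.ramificationSubgroup (L ≃ₐ[K] L) i) = 3) ∧
      ord (𝔓.under R) (c₂ ^ 2 * c₁ ^ 2 - 4 * c₁ ^ 3 - 4 * c₂ ^ 3 * c₀ - 27 * c₀ ^ 2 +
        18 * c₂ * c₁ * c₀) = n ∧
      6 * b = Nat.card (𝔓.inertia (L ≃ₐ[K] L)) * (n - 2) ∧ 3 ≤ n := by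
  haveI : IsDedekindDomain (integralClosure R L) := integralClosure.isDedekindDomain R K L
  have h3S : (3 : integralClosure R L) ∈ 𝔓 := by
    have := Ideal.mem_comap.mp h3
    rwa [map_ofNat] at this
  have h2S : (2 : integralClosure R L) ∉ 𝔓 := fun h2 ↦ by
    have : (1 : integralClosure R L) ∈ 𝔓 := by
      have e : (1 : integralClosure R L) = 3 - 2 := by norm_num
      rw [e]; exact Ideal.sub_mem _ h3S h2
    exact Ideal.IsPrime.ne_top' ((Ideal.eq_top_iff_one _).mpr this)
  have h6 : Nat.card (L ≃ₐ[K] L) ∣ 6 := card_dvd_six (K := K) hV₁ hV₂ hV₃ h12 h13 h23 hfaith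
  have hordθ : ord 𝔓 θ₁ = 2 := by
    rcases card_inertia_eq_three_or_six (K := K) 𝔓 h𝔓 hV₁ hV₂ hV₃ hc₂ hc₁ hc₀ hc₀' h12 h13 h23
      hfaith with ⟨h, -⟩ | ⟨-, h⟩
    · rw [hcard] at h; exact absurd h (by norm_num)
    · exact h
  obtain ⟨τ, hτI, hτord, hcyc⟩ := exists_three_cycle_mem_inertia (K := K) 𝔓 hV₁ hV₂ hV₃ h12 h13 h23
    hfaith (by rw [hcard]; norm_num)
  have hτ𝔓 : τ • 𝔓 = 𝔓 := 𝔓.inertia_le_stabilizer hτI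
  have hp : 𝔓.under R ≠ ⊥ := Ideal.IsIntegral.comap_ne_bot _ h𝔓
  set disc := c₂ ^ 2 * c₁ ^ 2 - 4 * c₁ ^ 3 - 4 * c₂ ^ 3 * c₀ - 27 * c₀ ^ 2 + 18 * c₂ * c₁ * c₀
    with hdisc
  have hn3 : ((3 : ℕ) : ℕ∞) ≤ ord (𝔓.under R) disc :=
    (mem_pow_iff_le_ord _).mp (discr_mem_pow_three hc₂ hc₁ hc₀ h3)
  have he6 : (𝔓.under R).ramificationIdx' 𝔓 = 6 := by
    rw [ramificationIdx'_under_base_eq_card_inertia (K := K) 𝔓 h𝔓, hcard]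
  -- the oriented core argument, for either orientation of `τ`
  have core : ∀ {η₂ η₃ : integralClosure R L},
      θ₁ + η₂ + η₃ = -algebraMap R _ c₂ → θ₁ * η₂ + θ₁ * η₃ + η₂ * η₃ = algebraMap R _ c₁ →
      θ₁ * η₂ * η₃ = -algebraMap R _ c₀ → θ₁ ≠ η₂ → θ₁ ≠ η₃ → η₂ ≠ η₃ →
      (∀ g : L ≃ₐ[K] L, g • θ₁ = θ₁ → g • η₂ = η₂ → g • η₃ = η₃ → g = 1) →
      τ • θ₁ = η₂ → τ • η₂ = η₃ → τ • η₃ = θ₁ →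
      ∃ b n : ℕ, 1 ≤ b ∧
        (∀ i, 1 ≤ i → (𝔓.ramificationSubgroup (L ≃ₐ[K] L) i ≠ ⊥ ↔ i ≤ b)) ∧
        (∀ i, 1 ≤ i → i ≤ b → Nat.card (𝔓.ramificationSubgroup (L ≃ₐ[K] L) i) = 3) ∧
        ord (𝔓.under R) disc = n ∧ 6 * b = Nat.card (𝔓.inertia (L ≃ₐ[K] L)) * (n - 2) ∧ 3 ≤ n := by
    intro η₂ η₃ gV₁ gV₂ gV₃ g12 g13 g23 gfaith g1 g2 g3
    have hrel := ramificationIdx'_mul_ord_discr_eq (K := K) 𝔓 h𝔓 gV₁ gV₂ gV₃ hτ𝔓 g1 g2 g3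
    rw [he6, ← hdisc] at hrel
    obtain ⟨t, ht⟩ := exists_ord_eq_natCast 𝔓 h𝔓 (sub_ne_zero.mpr g12)
    rw [ht] at hrel
    have hdisc0 : disc ≠ 0 := by
      rintro h0
      rw [h0, ord_zero, ENat.mul_top (by norm_num)] at hrel
      exact absurd hrel.symm (by exact_mod_cast ENat.coe_ne_top (6 * t))
    obtain ⟨n, hn⟩ := exists_ord_eq_natCast (𝔓.under R) hp hdisc0
    rw [hn] at hrel hn3
    have hnt : 6 * n = 6 * t := by exact_mod_cast hrel
    have hn3' : 3 ≤ n := by exact_mod_cast hn3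
    have hnt' : n = t := by omega
    subst hnt'
    -- `n` is odd, `n = 2k + 1`, `k ≥ 1`
    have hodd : Odd n := odd_ord_sub_of_card_inertia_eq_six (K := K) 𝔓 h𝔓 h2S h3S gV₁ gV₂ gV₃
      g12 g13 g23 gfaith hτ𝔓 g1 g2 g3 hcard ht
    obtain ⟨k, hk⟩ := hodd
    subst hk
    have hk1 : 1 ≤ k := by omega
    obtain ⟨y, hy, hy2, hordτy⟩ := exists_uniformizer_of_card_inertia_eq_six (K := K) 𝔓 h𝔓 h2S
      gV₁ gV₂ gV₃ g12 g13 g23 gfaith hτ𝔓 g1 g2 g3 hcard hordθ ht hk1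
    -- `τ ∈ G_i ↔ i + 1 ≤ 2k`
    have hmem : ∀ i, τ ∈ 𝔓.ramificationSubgroup (L ≃ₐ[K] L) i ↔ i + 1 ≤ 2 * k := by
      intro i
      rw [mem_ramificationSubgroup_iff_of_mem_inertia (K := K) 𝔓 h𝔓 hτI hy hy2 i, mem_pow_iff_le_ord,
        hordτy]
      exact ⟨fun h ↦ by exact_mod_cast h, fun h ↦ by exact_mod_cast h⟩
    refine ⟨2 * k - 1, 2 * k + 1, by omega, fun i hi ↦ ?_, fun i hi hib ↦ ?_, hn, by rw [hcard]; omega,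
      by omega⟩
    · rw [ramificationSubgroup_ne_bot_iff_mem (K := K) 𝔓 h3S gV₁ gV₂ gV₃ g12 g13 g23 gfaith g1 g2 g3 hi,
        hmem]
      omega
    · exact card_ramificationSubgroup_eq_three (K := K) 𝔓 h3S h6 hτord hi ((hmem i).mpr (by omega))
  rcases hcyc with ⟨h1, h2, h3'⟩ | ⟨h1, h3', h2⟩
  · exact core hV₁ hV₂ hV₃ h12 h13 h23 hfaith h1 h2 h3'
  · exact core (by rw [← hV₁]; ring) (by rw [← hV₂]; ring) (by rw [← hV₃]; ring) h13 h12
      (Ne.symm h23) (fun g g1 g3 g2 ↦ hfaith g g1 g2 g3) h1 h3' h2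

/-! ### The filtration, unconditionally -/

include K in
/-- **The lower ramification filtration of the splitting field of an Eisenstein cubic in residue
characteristic `3`.**  Let `R` be a Dedekind domain with fraction field `K`, `L/K` finite Galois
with group `G`, `S = integralClosure R L`, `𝔓 ≠ 0` a maximal ideal of `S` with separable residue
extension and `3 ∈ 𝔓 ∩ R = 𝔭`; let `θ₁, θ₂, θ₃ ∈ S` be distinct with
`(X - θ₁)(X - θ₂)(X - θ₃) = X³ + c₂X² + c₁X + c₀`, `cᵢ ∈ R`, **Eisenstein at `𝔭`**
(`c₂, c₁, c₀ ∈ 𝔭`, `c₀ ∉ 𝔭²`), and suppose `G` acts faithfully on `{θ₁, θ₂, θ₃}`.  Let `G_i` be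
the lower ramification groups of `𝔓` and `disc = c₂²c₁² - 4c₁³ - 4c₂³c₀ - 27c₀² + 18c₂c₁c₀`.  Then
there are `b ≥ 1` and `n = v_𝔭(disc) ≥ 3` with

* `G_i ≠ 1 ↔ i ≤ b` for every `i ≥ 1`, and `#G_i = 3` for `1 ≤ i ≤ b`;
* **`6b = #G₀ · (n - 2)`**.

(`e = #G₀ ∈ {3, 6}`, `card_inertia_eq_three_or_six`; the two cases are
`exists_break_of_card_inertia_eq_three` and `…_six`.)  Consequently
`Σ_{i ≥ 1} (#G_i/#G₀) · 2 = 6b/#G₀ = n - 2` — the value of Silverman's `δ` for a Galois module on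
which the `G_i`, `i ≥ 1`, act without fixed points exactly when non-trivial (the `2`-torsion of
an elliptic curve whose `2`-division field is generated by an Eisenstein cubic: Kodaira types
`II`, `IV`, `IV*`, `II*` at `p = 3`, *ATAEC* PDF pp. 368–370).
[cite: SilvermanATAEC1994, proof of Thm. IV.11.1 for p = 3 (PDF pp. 366–370)]
[cite: SerreLocalFields1979, Ch. IV §1 Lemma 1, Prop. 2; §2 Prop. 5, 7 and Cor. 1, 3] -/
theorem exists_break
    [Algebra.IsSeparable (R ⧸ 𝔓.under R) (integralClosure R L ⧸ 𝔓)] (h𝔓 : 𝔓 ≠ ⊥)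
    (h3 : (3 : R) ∈ 𝔓.under R)
    {θ₁ θ₂ θ₃ : integralClosure R L} {c₂ c₁ c₀ : R}
    (hV₁ : θ₁ + θ₂ + θ₃ = -algebraMap R _ c₂) (hV₂ : θ₁ * θ₂ + θ₁ * θ₃ + θ₂ * θ₃ = algebraMap R _ c₁)
    (hV₃ : θ₁ * θ₂ * θ₃ = -algebraMap R _ c₀)
    (hc₂ : c₂ ∈ 𝔓.under R) (hc₁ : c₁ ∈ 𝔓.under R) (hc₀ : c₀ ∈ 𝔓.under R)
    (hc₀' : c₀ ∉ (𝔓.under R) ^ 2)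
    (h12 : θ₁ ≠ θ₂) (h13 : θ₁ ≠ θ₃) (h23 : θ₂ ≠ θ₃)
    (hfaith : ∀ g : L ≃ₐ[K] L, g • θ₁ = θ₁ → g • θ₂ = θ₂ → g • θ₃ = θ₃ → g = 1) :
    ∃ b n : ℕ, 1 ≤ b ∧
      (∀ i, 1 ≤ i → (𝔓.ramificationSubgroup (L ≃ₐ[K] L) i ≠ ⊥ ↔ i ≤ b)) ∧
      (∀ i, 1 ≤ i → i ≤ b → Nat.card (𝔓.ramificationSubgroup (L ≃ₐ[K] L) i) = 3) ∧
      ord (𝔓.under R) (c₂ ^ 2 * c₁ ^ 2 - 4 * c₁ ^ 3 - 4 * c₂ ^ 3 * c₀ - 27 * c₀ ^ 2 +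
        18 * c₂ * c₁ * c₀) = n ∧
      6 * b = Nat.card (𝔓.inertia (L ≃ₐ[K] L)) * (n - 2) ∧ 3 ≤ n := by
  rcases card_inertia_eq_three_or_six (K := K) 𝔓 h𝔓 hV₁ hV₂ hV₃ hc₂ hc₁ hc₀ hc₀' h12 h13 h23 hfaith
    with ⟨hcard, -⟩ | ⟨hcard, -⟩
  · exact exists_break_of_card_inertia_eq_three (K := K) 𝔓 h𝔓 h3 hV₁ hV₂ hV₃ hc₂ hc₁ hc₀ hc₀' h12 h13
      h23 hfaith hcard
  · exact exists_break_of_card_inertia_eq_six (K := K) 𝔓 h𝔓 h3 hV₁ hV₂ hV₃ hc₂ hc₁ hc₀ hc₀' h12 h13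
      h23 hfaith hcard

end Literature.NumberTheory.GaloisRepresentations

end
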